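import Literature.MathematicalPhysics.QuantumFieldTheory.Balaban1983to89.B9Thm39CinvSandwichQ
import Literature.MathematicalPhysics.QuantumFieldTheory.Balaban1983to89.B9B8KnitLetterResolvent

/-!
# `Balaban1983to89.B9B8KnitLetterQpDiff` — THE BLOCK-AVERAGING LETTERS `Q′(U)`, `Q′*(U)` OF [B9] (3.21)∕(3.24) AT TWO TRANSPORTER TABLES: their
# DIFFERENCES `Q′(U; par₁) − Q′(U; par₂)`, `Q′*(U; par₁) − Q′*(U; par₂)` are block-local two-space letters with the SMALL diagonal majorant
# `2δ_τ·M₂Σ_j‖b_j‖·𝟙[a = a′]` whenever the two tables' block legs are contraction pairs within `δ_τ` of each other; at def-Y's letter of record `parSymY`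
# and print's knit letter `parKnitY` on [B7]'s class (52), `δ_τ = 8(d+1)²α₀′` (junction J-B file 5b) — the first ingredient of the C-line sym→knit transfer
# (junction J-B file 23a, seat p33; consumer: file 23b's majorant of `X(U; parSymY) − X(U; parKnitY)`, `X = Q′G′²Q′*`)

statement-level skeleton of published theorems with citation tags; proofs where landed; nothing here is a claim about the
Yang–Mills mass gap

T. Bałaban, *Propagators for lattice gauge theories in a background field*, Commun. Math. Phys. **99** (1985) 389–434 [`Balaban1985BackgroundPropagators`,
"[B9]"]; T. Bałaban, *Propagators and renormalization transformations for lattice gauge theories. II*, Commun. Math. Phys. **96** (1984) 223–250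
[`Balaban1984PropagatorsII`, "[4]"]; T. Bałaban, *Averaging operations for lattice gauge theories*, Commun. Math. Phys. **98** (1985) 17–51
[`Balaban1985Averaging`, "[B7]"].

THE PRINT.  [B9] (3.21) p. 394 (the covariant block average `Q′(U)` with transporters «U(Γ_{y,x})» along contours inside the block), (3.24)–(3.25) p. 394–395 (its
adjoint `Q′*(U)` in «R = I − G′Q′*(Q′G′²Q′*)⁻¹Q′G′»), (3.19) p. 393 (the composite contours «(52), (53) in [5]» — the knit letter), Thm 3.2 (3.48) p. 398; [4]
(2.14)–(2.17) p. 225 (`Q′`, `Q′*` as kernels), (2.51)–(2.52) p. 232 («|(Tλ)(x)| ≦ K(y,y′)|λ|», «A composition of operators preserves the above property»); [B7]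
(17)–(20) pp. 20–21 (conjugations `R(V)X = VXV⁻¹` in operator norm), (44) p. 24, (52)–(53) pp. 26–27 (the class and the O(α₀) closeness of the averaged links).

WHY THIS FILE ∕ THE ARGUMENT.  The knit consumer (`B8Thm2TorusLetters.LettersAt`, junction J-B files 17–19) reads `C(U) = (Q′G′²Q′*)⁻¹` at print's transporters
`parKnitY`, while sub-row G-B9-LETTERS proves Theorem 3.2 (3.48) at def-Y's letter of record `parSymY` (p21's M5.6; seat p33's FILE 10
`B9Thm32CinvAtMemberOfCubeData`).  Junction file 9 transferred `G′` between the two letters by a resolvent expansion; files 23a–23c do the same for `C`: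
`X_knit⁻¹ = X_sym⁻¹ + X_knit⁻¹(X_sym − X_knit)X_sym⁻¹` with `X = Q′G′²Q′*`, and `X_sym − X_knit` is small because (i) `G′_sym − G′_knit = −G′_knit·E·G′_sym` (file 8)
and (ii) the letters `Q′`, `Q′*` at the two tables differ by transporters within `δ_τ = 8(d+1)²α₀′` of each other (file 5b `norm_parKnitY_sub_parSymY_le`: the
`Q′`-transporter `qpT par U s z = par U c_s z` IS the block leg compared there).  THIS FILE is ingredient (ii): §1 the pointwise bounds `‖((Q′₁ − Q′₂)Λ)(s)‖ ≤
2δ_τ·max_{Δ(s)}‖Λ‖`, `‖((Q′₁* − Q′₂*)λ)(z)‖ ≤ 2δ_τ‖λ(s_z)‖` (`‖R(V)X − R(V′)X‖ ≤ 2‖V − V′‖·‖X‖`, file 8's `norm_R_sub_R_le`); §2 the two-space diagonal majorants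
`2δ_τ·M₂Σ‖b‖·𝟙` in real coordinates (p21's `hasMajorantHom_conjHom_QpY`∕`QpsY` pattern); §3 at `(parSymY, parKnitY)` on the class (52): `δ_τ = 8(d+1)²α₀′`.

CITATION HEADER (lean-in-tree rule).  Cell `lit-balaban`, sub-row G-B9-LETTERS, junction J-B file 23a → seat `lit-balaban-p33` gen 98.  REUSED BY NAME: p21's
`B9Thm39CinvSandwichQ` (`QpY_apply_eq_zero_of`, `QpsY_apply`, `sum_abs_qpK_le_one`), def-Y `Node00.{QpY, QpsY, qpT, qpK, trLiftY_apply}`, p33 J-B 8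
`B9B8KnitLetterResolvent.norm_R_sub_R_le`, J-B 5b `B9B8KnitVsTaxicab.norm_parKnitY_sub_parSymY_le`, J-B 4b `B9B8KnitLetterRegular.parKnitY_mem_of_pdev`,
`B9Eq376POneLetters.conjHom`, `B6RandomWalkHom.HasMajorantHom`, `B9Eq352DivFormLetters.coordEquiv`∕`norm_coordSymm_apply_le`.

WHAT THIS FILE PROVES (sorry-free; no definitions).
* §1 `QpY_sub_apply`, ★ `norm_QpY_sub_apply_le`, ★ `norm_QpsY_sub_apply_le` (matrix fibre, contraction pairs within `δ_τ`).
* §2 ★★ `hasMajorantHom_conjHom_QpY_sub`, ★★ `hasMajorantHom_conjHom_QpsY_sub` — `conjHom b (Q′(U;par₁) − Q′(U;par₂))` resp. `conjHom b (Q′*(U;par₁) − Q′*(U;par₂))`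
  have the two-space majorant `𝟙[a = a′]·(2δ_τ·M₂Σ_j‖b_j‖)` between def-Y's site carrier (`(z,j) ↦ ιB(Δ z)`) and block carrier (`(s,j) ↦ ιB s`).
* §3 ★★ `hasMajorantHom_conjHom_QpY_sym_sub_knit`, ★★ `hasMajorantHom_conjHom_QpsY_sym_sub_knit` — at `(parSymY, parKnitY)` for `G ≤ U(N)` averaging-closed,
  `N ≥ 1`, a `G`-valued `U` with `pdev (liftCfg U) < α₀′(L^k)⁻²` (`0 < α₀′`, `C₀α₀′ ≤ ⅓`, `2α₀′ ≤ c₂′`): the constant is `16(d+1)²α₀′·M₂Σ_j‖b_j‖`; and the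
  contractivity of both tables (`qpT_parSymY_bicontractive`, `qpT_parKnitY_bicontractive`).

HONEST SCOPE.  Finite-dimensional bookkeeping at `𝔸 = M_N(ℂ)` (operator norm); the transporters enter through contractivity and file 5b's closeness only; the
factor `(L^{j(s)})²(L^k)⁻² ≤ 1` of file 5b is discarded (`j(s) ≤ k`).  Nothing of Theorems 3.1∕3.2 is asserted; count-neutral; nothing continuum, nothing about
OS axioms or the mass gap.  No `sorry`, no `axiom`, no `… : Prop` fact, no `instance`, no `notation`, no `def`.  NEW file; nothing landed is modified.  Net new
unproved facts: 0.  Seat `lit-balaban-p33` gen 98, 2026-08-28.  RELATED, NOT DUPLICATED (searched 2026-08-28: `lean search 'QpY_sub|QpsY_sub|conjHom_QpY_sub' --decl`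
= ∅): p21's `hasMajorantHom_conjHom_QpY`∕`QpsY` (ONE table, constant `M₂Σ‖b‖`; §2 is the two-table difference with the same proof skeleton), p21's E2-4c
`B9Eq357CubeQpDiffMajorant` (the cube letter `Q′_□(Ṽ) − Q′_□(1)`: one table, two FIELDS — a different difference).
-/

noncomputable section

namespace Literature.MathematicalPhysics.QuantumFieldTheory.Balaban1983to89.B9B8KnitLetterQpDiff

open Node00
open B6Geom246MultiLevelBox (blkOf)
open B6KLevelCensusIndexV1 (KIdx)
open B6RandomWalk (HasMajorant BlockSupp)
open B6RandomWalkHom (HasMajorantHom)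
open B9Thm34Ext (toB6)
open B9GeoNormsKLevelV1 (geo9K)
open B9Eq39Adjoint (R)
open B9Eq352DivFormLetters (coordEquiv coordEquiv_symm_apply norm_coordSymm_apply_le)
open B9Eq376POneLetters (conjHom conjHom_apply)
open B9Thm39CinvSandwichQ (QpY_apply_eq_zero_of QpsY_apply sum_abs_qpK_le_one)
open B9Eq3104CutoffCommutatorSizes (qpK_ne_zero_imp)
open B7Prop1Explicit (mem_U1)
open B7Prop2Explicit (AvgClosed pdev C0 c2' unitaryUnits unitaryUnits_le_U1)
open B9B8CarrierDictionary (liftCfg)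
open B9B8AveragingJunction (parKnitY)
open B9B8KnitLetterRegular (parKnitY_mem_of_pdev)
open B9B8KnitVsTaxicab (norm_parKnitY_sub_parSymY_le)
open B9B8KnitLetterResolvent (norm_R_sub_R_le)
open scoped Matrix Matrix.Norms.L2Operator

variable {d ℓ : ℕ} {hd : 1 ≤ d + 1} {hL : Odd (ℓ + 1) ∧ 1 < ℓ + 1} {b₀ b₁ : ℝ}
variable (i : KIdx d ℓ hd hL b₀ b₁) {N : ℕ}

/-! ## §1 The two letters at two transporter tables, pointwise -/

section Pointwise

variable (par₁ par₂ : SiteParY (Matrix (Fin N) (Fin N) ℂ) i) (U : CfgY (Matrix (Fin N) (Fin N) ℂ) i)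

/-- the difference of the block averages at two tables, as one sum over the block: `((Q′₁ − Q′₂)Λ)(s) = Σ_z q(s,z)·(R(τ₁(s,z)) − R(τ₂(s,z)))Λ(z)`.
[cite: Balaban1985BackgroundPropagators, (3.21) p.394; Balaban1984PropagatorsII, (2.14) p.225] -/
theorem QpY_sub_apply (Λ : SiteY i → Matrix (Fin N) (Fin N) ℂ) (s : BlkY i) :
    (QpY i par₁ U Λ - QpY i par₂ U Λ) s = ∑ z, (((qpK i s z : ℝ)) : ℂ) • (R (qpT i par₁ U s z) (Λ z) - R (qpT i par₂ U s z) (Λ z)) := by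
  rw [Pi.sub_apply, QpY, QpY, trLiftY_apply, trLiftY_apply, ← Finset.sum_sub_distrib]
  exact Finset.sum_congr rfl fun z _ => (smul_sub _ _ _).symm

/-- ★ **`Q′(U; par₁) − Q′(U; par₂)` IS SMALL IN THE BLOCK SUP**: block legs contraction pairs within `δ_τ` on `Δ(s)` and `‖Λ(z)‖ ≦ B` on `Δ(s)` give
`‖((Q′₁ − Q′₂)Λ)(s)‖ ≦ 2δ_τ·B` (`Σ_z|q(s,z)| ≦ 1`, `‖R(V)X − R(V′)X‖ ≦ 2‖V − V′‖‖X‖`). [cite: Balaban1985BackgroundPropagators, (3.21) p.394; Balaban1985Averaging, (17)–(20) pp.20–21] -/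
theorem norm_QpY_sub_apply_le [Nonempty (Fin N)] (s : BlkY i) {δ B : ℝ} (hδ : 0 ≤ δ) (hB : 0 ≤ B)
    (h₁ : ∀ z : SiteY i, blkOf i.D.toDomains z = s →
      ‖(qpT i par₁ U s z : Matrix (Fin N) (Fin N) ℂ)‖ ≤ 1 ∧ ‖(((qpT i par₁ U s z)⁻¹ : (Matrix (Fin N) (Fin N) ℂ)ˣ) : Matrix (Fin N) (Fin N) ℂ)‖ ≤ 1)
    (h₂ : ∀ z : SiteY i, blkOf i.D.toDomains z = s →
      ‖(qpT i par₂ U s z : Matrix (Fin N) (Fin N) ℂ)‖ ≤ 1 ∧ ‖(((qpT i par₂ U s z)⁻¹ : (Matrix (Fin N) (Fin N) ℂ)ˣ) : Matrix (Fin N) (Fin N) ℂ)‖ ≤ 1)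
    (hd : ∀ z : SiteY i, blkOf i.D.toDomains z = s →
      ‖(qpT i par₁ U s z : Matrix (Fin N) (Fin N) ℂ) - qpT i par₂ U s z‖ ≤ δ)
    (Λ : SiteY i → Matrix (Fin N) (Fin N) ℂ) (hΛ : ∀ z, blkOf i.D.toDomains z = s → ‖Λ z‖ ≤ B) :
    ‖(QpY i par₁ U Λ - QpY i par₂ U Λ) s‖ ≤ 2 * δ * B := by
  rw [QpY_sub_apply]
  have hterm : ∀ z : SiteY i, ‖(((qpK i s z : ℝ)) : ℂ) • (R (qpT i par₁ U s z) (Λ z) - R (qpT i par₂ U s z) (Λ z))‖ ≤ |qpK i s z| * (2 * δ * B) := by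
    intro z
    rw [norm_smul, Complex.norm_real, Real.norm_eq_abs]
    by_cases hq : qpK i s z = 0
    · rw [hq, abs_zero, zero_mul, zero_mul]
    · have hz := qpK_ne_zero_imp i hq
      refine mul_le_mul_of_nonneg_left ?_ (abs_nonneg _)
      exact (norm_R_sub_R_le (h₁ z hz) (h₂ z hz) (hd z hz) (Λ z)).trans (mul_le_mul_of_nonneg_left (hΛ z hz) (by positivity))
  calc ‖∑ z, (((qpK i s z : ℝ)) : ℂ) • (R (qpT i par₁ U s z) (Λ z) - R (qpT i par₂ U s z) (Λ z))‖
      ≤ ∑ z, |qpK i s z| * (2 * δ * B) := (norm_sum_le _ _).trans (Finset.sum_le_sum fun z _ => hterm z)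
    _ = (∑ z, |qpK i s z|) * (2 * δ * B) := by rw [Finset.sum_mul]
    _ ≤ 1 * (2 * δ * B) := mul_le_mul_of_nonneg_right (sum_abs_qpK_le_one i s) (by positivity)
    _ = 2 * δ * B := one_mul _

/-- ★ **`Q′*(U; par₁) − Q′*(U; par₂)` IS SMALL POINTWISE**: `((Q′₁* − Q′₂*)λ)(z) = (R(τ₁(s_z,z)⁻¹) − R(τ₂(s_z,z)⁻¹))λ(s_z)` and the inverses of contraction pairs
within `δ_τ` are contraction pairs within `δ_τ`, so `‖((Q′₁* − Q′₂*)λ)(z)‖ ≦ 2δ_τ‖λ(s_z)‖`. [cite: Balaban1985BackgroundPropagators, (3.24)–(3.25) p.395; Balaban1985Averaging, (17)–(20) pp.20–21] -/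
theorem norm_QpsY_sub_apply_le [Nonempty (Fin N)] (z : SiteY i) {δ : ℝ}
    (h₁ : ‖(qpT i par₁ U (blkOf i.D.toDomains z) z : Matrix (Fin N) (Fin N) ℂ)‖ ≤ 1 ∧
      ‖(((qpT i par₁ U (blkOf i.D.toDomains z) z)⁻¹ : (Matrix (Fin N) (Fin N) ℂ)ˣ) : Matrix (Fin N) (Fin N) ℂ)‖ ≤ 1)
    (h₂ : ‖(qpT i par₂ U (blkOf i.D.toDomains z) z : Matrix (Fin N) (Fin N) ℂ)‖ ≤ 1 ∧
      ‖(((qpT i par₂ U (blkOf i.D.toDomains z) z)⁻¹ : (Matrix (Fin N) (Fin N) ℂ)ˣ) : Matrix (Fin N) (Fin N) ℂ)‖ ≤ 1)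
    (hd : ‖(qpT i par₁ U (blkOf i.D.toDomains z) z : Matrix (Fin N) (Fin N) ℂ) - qpT i par₂ U (blkOf i.D.toDomains z) z‖ ≤ δ)
    (lam : BlkY i → Matrix (Fin N) (Fin N) ℂ) :
    ‖(QpsY i par₁ U lam - QpsY i par₂ U lam) z‖ ≤ 2 * δ * ‖lam (blkOf i.D.toDomains z)‖ := by
  letI : CStarAlgebra (Matrix (Fin N) (Fin N) ℂ) := {}
  rw [Pi.sub_apply, QpsY_apply, QpsY_apply]
  have h₁' : ‖(((qpT i par₁ U (blkOf i.D.toDomains z) z)⁻¹ : (Matrix (Fin N) (Fin N) ℂ)ˣ) : Matrix (Fin N) (Fin N) ℂ)‖ ≤ 1 ∧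
      ‖((((qpT i par₁ U (blkOf i.D.toDomains z) z)⁻¹)⁻¹ : (Matrix (Fin N) (Fin N) ℂ)ˣ) : Matrix (Fin N) (Fin N) ℂ)‖ ≤ 1 := by
    rw [inv_inv]; exact ⟨h₁.2, h₁.1⟩
  have h₂' : ‖(((qpT i par₂ U (blkOf i.D.toDomains z) z)⁻¹ : (Matrix (Fin N) (Fin N) ℂ)ˣ) : Matrix (Fin N) (Fin N) ℂ)‖ ≤ 1 ∧
      ‖((((qpT i par₂ U (blkOf i.D.toDomains z) z)⁻¹)⁻¹ : (Matrix (Fin N) (Fin N) ℂ)ˣ) : Matrix (Fin N) (Fin N) ℂ)‖ ≤ 1 := by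
    rw [inv_inv]; exact ⟨h₂.2, h₂.1⟩
  have hd' : ‖(((qpT i par₁ U (blkOf i.D.toDomains z) z)⁻¹ : (Matrix (Fin N) (Fin N) ℂ)ˣ) : Matrix (Fin N) (Fin N) ℂ) -
      (((qpT i par₂ U (blkOf i.D.toDomains z) z)⁻¹ : (Matrix (Fin N) (Fin N) ℂ)ˣ) : Matrix (Fin N) (Fin N) ℂ)‖ ≤ δ :=
    (B9B8AveragedBondsStraight.norm_inv_sub_inv_le (mem_U1.2 h₁) (mem_U1.2 h₂)).trans hd
  exact norm_R_sub_R_le h₁' h₂' hd' _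

end Pointwise

/-! ## §2 The differences in real coordinates: small block-diagonal two-space majorants -/

section Coordinates

variable {ι : Type} [Fintype ι] (b : Module.Basis ι ℝ (Matrix (Fin N) (Fin N) ℂ))
variable [Fintype (geo9K i).Site] [DecidableEq (geo9K i).Site] {Rr : ℝ} {Hp : Prop}
variable (ιB : BlkY i → IBondY i) (par₁ par₂ : SiteParY (Matrix (Fin N) (Fin N) ℂ) i) (U : CfgY (Matrix (Fin N) (Fin N) ℂ) i)

/-- ★★ **`Q′(U; par₁) − Q′(U; par₂)` IN REAL COORDINATES IS BLOCK-LOCAL WITH NORM `2δ_τ·M₂Σ_j‖b_j‖`**: the two-space majorant `𝟙[a = a′]·(2δ_τ·M₂Σ_j‖b_j‖)` from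
the site carrier (`(z, j) ↦ ιB(Δ z)`) to the block carrier (`(s, j) ↦ ιB s`), for block legs that are contraction pairs within `δ_τ` of each other on every block.
[cite: Balaban1985BackgroundPropagators, (3.21) p.394 + (3.42) p.397; Balaban1984PropagatorsII, (2.51) p.232 + (2.14) p.225; Balaban1985Averaging, (17)–(20) pp.20–21] -/
theorem hasMajorantHom_conjHom_QpY_sub [Nonempty (Fin N)] {δ : ℝ} (hδ : 0 ≤ δ)
    (h₁ : ∀ (s : BlkY i) (z : SiteY i), blkOf i.D.toDomains z = s →
      ‖(qpT i par₁ U s z : Matrix (Fin N) (Fin N) ℂ)‖ ≤ 1 ∧ ‖(((qpT i par₁ U s z)⁻¹ : (Matrix (Fin N) (Fin N) ℂ)ˣ) : Matrix (Fin N) (Fin N) ℂ)‖ ≤ 1)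
    (h₂ : ∀ (s : BlkY i) (z : SiteY i), blkOf i.D.toDomains z = s →
      ‖(qpT i par₂ U s z : Matrix (Fin N) (Fin N) ℂ)‖ ≤ 1 ∧ ‖(((qpT i par₂ U s z)⁻¹ : (Matrix (Fin N) (Fin N) ℂ)ˣ) : Matrix (Fin N) (Fin N) ℂ)‖ ≤ 1)
    (hd : ∀ (s : BlkY i) (z : SiteY i), blkOf i.D.toDomains z = s → ‖(qpT i par₁ U s z : Matrix (Fin N) (Fin N) ℂ) - qpT i par₂ U s z‖ ≤ δ)
    {M₂ : ℝ} (hM₂ : 0 ≤ M₂) (hrepr : ∀ (v : Matrix (Fin N) (Fin N) ℂ) (j : ι), |b.repr v j| ≤ M₂ * ‖v‖) :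
    HasMajorantHom (g := toB6 (geo9K i) Rr Hp) (fun p : SiteY i × ι => ιB (blkOf i.D.toDomains p.1)) (fun q : BlkY i × ι => ιB q.1)
      (conjHom b ((QpY i par₁ U).restrictScalars ℝ - (QpY i par₂ U).restrictScalars ℝ))
      (fun a a' : (geo9K i).Site => if a = a' then 2 * δ * (M₂ * ∑ j, ‖b j‖) else 0) := by
  intro y' μ B hμ q
  rw [conjHom_apply, LinearMap.sub_apply, LinearMap.restrictScalars_apply, LinearMap.restrictScalars_apply]
  dsimp only
  have hSb : 0 ≤ ∑ j, ‖b j‖ := Finset.sum_nonneg fun j _ => norm_nonneg _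
  split_ifs with hq
  · -- the block `q.1` IS the source block
    have hbd : ∀ p : SiteY i × ι, blkOf i.D.toDomains p.1 = q.1 → |μ p| ≤ B := fun p hp => hμ.bound p ((congrArg ιB hp).trans hq)
    have hSB : 0 ≤ (∑ j, ‖b j‖) * B := mul_nonneg hSb hμ.nonneg
    have h1 : ‖(QpY i par₁ U ((coordEquiv b).symm μ) - QpY i par₂ U ((coordEquiv b).symm μ)) q.1‖ ≤ 2 * δ * ((∑ j, ‖b j‖) * B) :=
      norm_QpY_sub_apply_le i par₁ par₂ U q.1 hδ hSB (h₁ q.1) (h₂ q.1) (hd q.1) _ fun z hz =>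
        norm_coordSymm_apply_le b μ z B fun j => hbd (z, j) hz
    calc |b.repr ((QpY i par₁ U ((coordEquiv b).symm μ) - QpY i par₂ U ((coordEquiv b).symm μ)) q.1) q.2|
        ≤ M₂ * ‖(QpY i par₁ U ((coordEquiv b).symm μ) - QpY i par₂ U ((coordEquiv b).symm μ)) q.1‖ := hrepr _ _
      _ ≤ M₂ * (2 * δ * ((∑ j, ‖b j‖) * B)) := mul_le_mul_of_nonneg_left h1 hM₂
      _ = 2 * δ * (M₂ * ∑ j, ‖b j‖) * B := by ring
  · -- a different block: both averages vanish
    have h0 : ∀ par : SiteParY (Matrix (Fin N) (Fin N) ℂ) i, QpY i par U ((coordEquiv b).symm μ) q.1 = 0 := fun par => by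
      refine QpY_apply_eq_zero_of i par U _ q.1 fun z hz => ?_
      rw [coordEquiv_symm_apply]
      refine Finset.sum_eq_zero fun j _ => ?_
      rw [hμ.off (z, j) fun h => hq ((congrArg ιB hz).symm.trans h), zero_smul]
    rw [Pi.sub_apply, h0, h0, sub_zero, map_zero, Finsupp.zero_apply, abs_zero, zero_mul]

/-- ★★ **`Q′*(U; par₁) − Q′*(U; par₂)` IN REAL COORDINATES IS BLOCK-LOCAL WITH NORM `2δ_τ·M₂Σ_j‖b_j‖`**: the two-space majorant `𝟙[a = a′]·(2δ_τ·M₂Σ_j‖b_j‖)` from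
the block carrier to the site carrier. [cite: Balaban1985BackgroundPropagators, (3.24)–(3.25) p.395 + (3.42) p.397; Balaban1984PropagatorsII, (2.51) p.232 + (2.16) p.225; Balaban1985Averaging, (17)–(20) pp.20–21] -/
theorem hasMajorantHom_conjHom_QpsY_sub [Nonempty (Fin N)] {δ : ℝ} (hδ : 0 ≤ δ)
    (h₁ : ∀ (s : BlkY i) (z : SiteY i), blkOf i.D.toDomains z = s →
      ‖(qpT i par₁ U s z : Matrix (Fin N) (Fin N) ℂ)‖ ≤ 1 ∧ ‖(((qpT i par₁ U s z)⁻¹ : (Matrix (Fin N) (Fin N) ℂ)ˣ) : Matrix (Fin N) (Fin N) ℂ)‖ ≤ 1)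
    (h₂ : ∀ (s : BlkY i) (z : SiteY i), blkOf i.D.toDomains z = s →
      ‖(qpT i par₂ U s z : Matrix (Fin N) (Fin N) ℂ)‖ ≤ 1 ∧ ‖(((qpT i par₂ U s z)⁻¹ : (Matrix (Fin N) (Fin N) ℂ)ˣ) : Matrix (Fin N) (Fin N) ℂ)‖ ≤ 1)
    (hd : ∀ (s : BlkY i) (z : SiteY i), blkOf i.D.toDomains z = s → ‖(qpT i par₁ U s z : Matrix (Fin N) (Fin N) ℂ) - qpT i par₂ U s z‖ ≤ δ)
    {M₂ : ℝ} (hM₂ : 0 ≤ M₂) (hrepr : ∀ (v : Matrix (Fin N) (Fin N) ℂ) (j : ι), |b.repr v j| ≤ M₂ * ‖v‖) :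
    HasMajorantHom (g := toB6 (geo9K i) Rr Hp) (fun q : BlkY i × ι => ιB q.1) (fun p : SiteY i × ι => ιB (blkOf i.D.toDomains p.1))
      (conjHom b ((QpsY i par₁ U).restrictScalars ℝ - (QpsY i par₂ U).restrictScalars ℝ))
      (fun a a' : (geo9K i).Site => if a = a' then 2 * δ * (M₂ * ∑ j, ‖b j‖) else 0) := by
  intro y' μ B hμ p
  rw [conjHom_apply, LinearMap.sub_apply, LinearMap.restrictScalars_apply, LinearMap.restrictScalars_apply]
  dsimp only
  have hSb : 0 ≤ ∑ j, ‖b j‖ := Finset.sum_nonneg fun j _ => norm_nonneg _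
  split_ifs with hp
  · have hlam : ‖(coordEquiv b).symm μ (blkOf i.D.toDomains p.1)‖ ≤ (∑ j, ‖b j‖) * B :=
      norm_coordSymm_apply_le b μ (blkOf i.D.toDomains p.1) B fun j => hμ.bound (blkOf i.D.toDomains p.1, j) hp
    have h1 : ‖(QpsY i par₁ U ((coordEquiv b).symm μ) - QpsY i par₂ U ((coordEquiv b).symm μ)) p.1‖ ≤ 2 * δ * ((∑ j, ‖b j‖) * B) :=
      (norm_QpsY_sub_apply_le i par₁ par₂ U p.1 (h₁ _ p.1 rfl) (h₂ _ p.1 rfl) (hd _ p.1 rfl) _).trans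
        (mul_le_mul_of_nonneg_left hlam (by positivity))
    calc |b.repr ((QpsY i par₁ U ((coordEquiv b).symm μ) - QpsY i par₂ U ((coordEquiv b).symm μ)) p.1) p.2|
        ≤ M₂ * ‖(QpsY i par₁ U ((coordEquiv b).symm μ) - QpsY i par₂ U ((coordEquiv b).symm μ)) p.1‖ := hrepr _ _
      _ ≤ M₂ * (2 * δ * ((∑ j, ‖b j‖) * B)) := mul_le_mul_of_nonneg_left h1 hM₂
      _ = 2 * δ * (M₂ * ∑ j, ‖b j‖) * B := by ring
  · have h0 : ∀ par : SiteParY (Matrix (Fin N) (Fin N) ℂ) i, QpsY i par U ((coordEquiv b).symm μ) p.1 = 0 := fun par => by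
      rw [QpsY_apply, coordEquiv_symm_apply]
      have hs : ∑ j, μ (blkOf i.D.toDomains p.1, j) • b j = 0 :=
        Finset.sum_eq_zero fun j _ => by rw [hμ.off (blkOf i.D.toDomains p.1, j) hp, zero_smul]
      rw [hs, B9Eq39Adjoint.R_zero]
    rw [Pi.sub_apply, h0, h0, sub_zero, map_zero, Finsupp.zero_apply, abs_zero, zero_mul]

end Coordinates

/-! ## §3 At def-Y's letter of record and print's knit letter on [B7]'s class (52): `δ_τ = 8(d+1)²α₀′` -/

section Letters

variable {G : Subgroup (Matrix (Fin N) (Fin N) ℂ)ˣ}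
variable {ι : Type} [Fintype ι] (b : Module.Basis ι ℝ (Matrix (Fin N) (Fin N) ℂ))
variable [Fintype (geo9K i).Site] [DecidableEq (geo9K i).Site] {Rr : ℝ} {Hp : Prop} (ιB : BlkY i → IBondY i)

omit [Fintype (geo9K i).Site] [DecidableEq (geo9K i).Site] in
/-- the `Q′`-transporters of def-Y's letter `parSymY` at a `G`-valued `U`, `G ≤ U(N)`, are contraction pairs.
[cite: Balaban1985BackgroundPropagators, (3.21) p.394, p.389 («G ⊂ U(N)»)] -/
theorem qpT_parSymY_bicontractive [Nonempty (Fin N)] (hG : G ≤ unitaryUnits (Matrix (Fin N) (Fin N) ℂ))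
    {U : CfgY (Matrix (Fin N) (Fin N) ℂ) i} (hU : ∀ μ x, U μ x ∈ G) (s : BlkY i) (z : SiteY i) :
    ‖(qpT i (parSymY i) U s z : Matrix (Fin N) (Fin N) ℂ)‖ ≤ 1 ∧
      ‖(((qpT i (parSymY i) U s z)⁻¹ : (Matrix (Fin N) (Fin N) ℂ)ˣ) : Matrix (Fin N) (Fin N) ℂ)‖ ≤ 1 := by
  letI : CStarAlgebra (Matrix (Fin N) (Fin N) ℂ) := {}
  exact mem_U1.1 (unitaryUnits_le_U1 (hG (parSymY_mem i hU _ _)))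

omit [Fintype (geo9K i).Site] [DecidableEq (geo9K i).Site] in
/-- the `Q′`-transporters of the knit letter `parKnitY` at a `G`-valued `U` on the class (52), `G ≤ U(N)` averaging-closed, are contraction pairs (file 4b: the knit
legs are `G`-valued). [cite: Balaban1985BackgroundPropagators, (3.19) p.393; Balaban1985Averaging, (52)–(53) pp.26–27] -/
theorem qpT_parKnitY_bicontractive [Nonempty (Fin N)] (hG : G ≤ unitaryUnits (Matrix (Fin N) (Fin N) ℂ)) (hGa : AvgClosed (d + 1) (ℓ + 1) G)
    {U : CfgY (Matrix (Fin N) (Fin N) ℂ) i} (hU : ∀ μ x, U μ x ∈ G) {α₀' : ℝ} (hα : 0 < α₀') (hα3 : C0 (d + 1) * α₀' ≤ 1 / 3)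
    (hα2 : 2 * α₀' ≤ c2' (d + 1) (ℓ + 1)) (h52 : pdev (liftCfg U) < α₀' * ((((ℓ + 1 : ℕ) : ℝ) ^ i.k)⁻¹) ^ 2) (s : BlkY i) (z : SiteY i) :
    ‖(qpT i (parKnitY i) U s z : Matrix (Fin N) (Fin N) ℂ)‖ ≤ 1 ∧
      ‖(((qpT i (parKnitY i) U s z)⁻¹ : (Matrix (Fin N) (Fin N) ℂ)ˣ) : Matrix (Fin N) (Fin N) ℂ)‖ ≤ 1 := by
  letI : CStarAlgebra (Matrix (Fin N) (Fin N) ℂ) := {}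
  exact mem_U1.1 (unitaryUnits_le_U1 (hG (parKnitY_mem_of_pdev i hGa hU hα hα3 hα2 h52 _ _)))

omit [Fintype (geo9K i).Site] [DecidableEq (geo9K i).Site] in
/-- ★ the `Q′`-transporters of the two letters differ by at most `8(d+1)²α₀′` on every block (file 5b with the factor `(L^{j(s)})²(L^k)⁻² ≦ 1` discarded).
[cite: Balaban1985BackgroundPropagators, (3.19) p.393, (3.21) p.394; Balaban1985Averaging, (52)–(53) pp.26–27, (44) p.24] -/
theorem norm_qpT_sym_sub_knit_le [Nonempty (Fin N)] (hGa : AvgClosed (d + 1) (ℓ + 1) G) {U : CfgY (Matrix (Fin N) (Fin N) ℂ) i} (hU : ∀ μ x, U μ x ∈ G)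
    {α₀' : ℝ} (hα : 0 < α₀') (hα3 : C0 (d + 1) * α₀' ≤ 1 / 3) (hα2 : 2 * α₀' ≤ c2' (d + 1) (ℓ + 1))
    (h52 : pdev (liftCfg U) < α₀' * ((((ℓ + 1 : ℕ) : ℝ) ^ i.k)⁻¹) ^ 2) (s : BlkY i) (z : SiteY i) (hz : blkOf i.D.toDomains z = s) :
    ‖(qpT i (parSymY i) U s z : Matrix (Fin N) (Fin N) ℂ) - qpT i (parKnitY i) U s z‖ ≤ 8 * ((d : ℝ) + 1) ^ 2 * α₀' := by
  have h52' : pdev (liftCfg U) < α₀' * ((((ℓ : ℝ) + 1) ^ i.k)⁻¹) ^ 2 := by push_cast at h52; exact h52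
  have h := norm_parKnitY_sub_parSymY_le i hd hGa hU hα hα3 hα2 h52' hz
  rw [← norm_neg, neg_sub] at h
  refine h.trans ?_
  -- `(L^{j(s)})²·((L^k)⁻¹)² ≤ 1` since `j(s) ≤ k`
  have hL1 : (1 : ℝ) ≤ (ℓ : ℝ) + 1 := by linarith [(Nat.cast_nonneg ℓ : (0 : ℝ) ≤ ℓ)]
  have hjk : s.1.1 ≤ i.k := (B6Geom246MultiLevelBox.scale_bounds i.D.toDomains s).2
  have hpow : ((ℓ : ℝ) + 1) ^ s.1.1 ≤ ((ℓ : ℝ) + 1) ^ i.k := pow_le_pow_right₀ hL1 hjk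
  have hk0 : 0 < ((ℓ : ℝ) + 1) ^ i.k := by positivity
  have hfac : (((ℓ : ℝ) + 1) ^ s.1.1) ^ 2 * ((((ℓ : ℝ) + 1) ^ i.k)⁻¹) ^ 2 ≤ 1 := by
    rw [← mul_pow, ← div_eq_mul_inv]
    exact pow_le_one₀ (by positivity) ((div_le_one hk0).2 hpow)
  calc 8 * ((d : ℝ) + 1) ^ 2 * α₀' * ((((ℓ : ℝ) + 1) ^ s.1.1) ^ 2 * ((((ℓ : ℝ) + 1) ^ i.k)⁻¹) ^ 2)
      ≤ 8 * ((d : ℝ) + 1) ^ 2 * α₀' * 1 := mul_le_mul_of_nonneg_left hfac (by positivity)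
    _ = 8 * ((d : ℝ) + 1) ^ 2 * α₀' := mul_one _

/-- ★★ **`Q′(U; parSymY) − Q′(U; parKnitY)` IN REAL COORDINATES: the two-space majorant `𝟙[a = a′]·16(d+1)²α₀′·M₂Σ_j‖b_j‖`** (site carrier → block carrier), for
`G ≤ U(N)` averaging-closed, `N ≥ 1`, a `G`-valued `U` on the class (52) and a real basis `b` with coordinate bound `M₂`.
[cite: Balaban1985BackgroundPropagators, (3.21) p.394, (3.19) p.393, Thm 3.2 (3.48) p.398; Balaban1984PropagatorsII, (2.51) p.232; Balaban1985Averaging, (52)–(53) pp.26–27] -/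
theorem hasMajorantHom_conjHom_QpY_sym_sub_knit [Nonempty (Fin N)] (hG : G ≤ unitaryUnits (Matrix (Fin N) (Fin N) ℂ)) (hGa : AvgClosed (d + 1) (ℓ + 1) G)
    {U : CfgY (Matrix (Fin N) (Fin N) ℂ) i} (hU : ∀ μ x, U μ x ∈ G) {α₀' : ℝ} (hα : 0 < α₀') (hα3 : C0 (d + 1) * α₀' ≤ 1 / 3)
    (hα2 : 2 * α₀' ≤ c2' (d + 1) (ℓ + 1)) (h52 : pdev (liftCfg U) < α₀' * ((((ℓ + 1 : ℕ) : ℝ) ^ i.k)⁻¹) ^ 2)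
    {M₂ : ℝ} (hM₂ : 0 ≤ M₂) (hrepr : ∀ (v : Matrix (Fin N) (Fin N) ℂ) (j : ι), |b.repr v j| ≤ M₂ * ‖v‖) :
    HasMajorantHom (g := toB6 (geo9K i) Rr Hp) (fun p : SiteY i × ι => ιB (blkOf i.D.toDomains p.1)) (fun q : BlkY i × ι => ιB q.1)
      (conjHom b ((QpY i (parSymY i) U).restrictScalars ℝ - (QpY i (parKnitY i) U).restrictScalars ℝ))
      (fun a a' : (geo9K i).Site => if a = a' then 2 * (8 * ((d : ℝ) + 1) ^ 2 * α₀') * (M₂ * ∑ j, ‖b j‖) else 0) :=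
  hasMajorantHom_conjHom_QpY_sub i b ιB (parSymY i) (parKnitY i) U (by positivity) (fun s z _ => qpT_parSymY_bicontractive i hG hU s z)
    (fun s z _ => qpT_parKnitY_bicontractive i hG hGa hU hα hα3 hα2 h52 s z) (fun s z hz => norm_qpT_sym_sub_knit_le i hGa hU hα hα3 hα2 h52 s z hz) hM₂ hrepr

/-- ★★ **`Q′*(U; parSymY) − Q′*(U; parKnitY)` IN REAL COORDINATES: the two-space majorant `𝟙[a = a′]·16(d+1)²α₀′·M₂Σ_j‖b_j‖`** (block carrier → site carrier).
[cite: Balaban1985BackgroundPropagators, (3.24)–(3.25) p.395, (3.19) p.393, Thm 3.2 (3.48) p.398; Balaban1984PropagatorsII, (2.51) p.232; Balaban1985Averaging, (52)–(53) pp.26–27] -/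
theorem hasMajorantHom_conjHom_QpsY_sym_sub_knit [Nonempty (Fin N)] (hG : G ≤ unitaryUnits (Matrix (Fin N) (Fin N) ℂ)) (hGa : AvgClosed (d + 1) (ℓ + 1) G)
    {U : CfgY (Matrix (Fin N) (Fin N) ℂ) i} (hU : ∀ μ x, U μ x ∈ G) {α₀' : ℝ} (hα : 0 < α₀') (hα3 : C0 (d + 1) * α₀' ≤ 1 / 3)
    (hα2 : 2 * α₀' ≤ c2' (d + 1) (ℓ + 1)) (h52 : pdev (liftCfg U) < α₀' * ((((ℓ + 1 : ℕ) : ℝ) ^ i.k)⁻¹) ^ 2)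
    {M₂ : ℝ} (hM₂ : 0 ≤ M₂) (hrepr : ∀ (v : Matrix (Fin N) (Fin N) ℂ) (j : ι), |b.repr v j| ≤ M₂ * ‖v‖) :
    HasMajorantHom (g := toB6 (geo9K i) Rr Hp) (fun q : BlkY i × ι => ιB q.1) (fun p : SiteY i × ι => ιB (blkOf i.D.toDomains p.1))
      (conjHom b ((QpsY i (parSymY i) U).restrictScalars ℝ - (QpsY i (parKnitY i) U).restrictScalars ℝ))
      (fun a a' : (geo9K i).Site => if a = a' then 2 * (8 * ((d : ℝ) + 1) ^ 2 * α₀') * (M₂ * ∑ j, ‖b j‖) else 0) :=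
  hasMajorantHom_conjHom_QpsY_sub i b ιB (parSymY i) (parKnitY i) U (by positivity) (fun s z _ => qpT_parSymY_bicontractive i hG hU s z)
    (fun s z _ => qpT_parKnitY_bicontractive i hG hGa hU hα hα3 hα2 h52 s z) (fun s z hz => norm_qpT_sym_sub_knit_le i hGa hU hα hα3 hα2 h52 s z hz) hM₂ hrepr

end Letters

end Literature.MathematicalPhysics.QuantumFieldTheory.Balaban1983to89.B9B8KnitLetterQpDiff

end
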